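import Mathlib
import HarnessLib
import HarnessLib.Audit
import Summits.HodgeConjecture.Statement
import Literature.AlgebraicGeometry.HodgeTheory.WeilClasses
import Literature.AlgebraicGeometry.Motives.AbelianVarietyProduct
import Literature.AlgebraicGeometry.Motives.CartierDivisorClassPullback
import Literature.NumberTheory.DiophantineGeometry.AVIsogenyQuasiInverse
import HarnessLib.Audit.Status.Attr

/-!
Route: HeckeOrbitCompactness

DORMANT since 2026-08-26T19:37:46Z (reconciler: no traction for 5 d (last activity item-evidence-added at 2026-08-21T18:49:17Z); parked, not closed — `ledger route dormant route-HodgeConjecture-HeckeOrbitCompactness --off` to reactivate) — unstaffed, not closed; items shared with open routes are served there. `ledger route dormant <id> --off` reactivates.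

# Route HeckeOrbitCompactness — Weil classes iff bounded cycle degree along the dense isogeny orbit
of split squares (Chow compactness)

It suffices to show X = OrbitDegreeBound — "cycles do not escape to infinity along the isogeny
orbit" (card degree-spectroscopy-hecke-orbit, second conforming attempt after the retired
sector-only route DegreeSpectroscopy). For every half-dimension n ≥ 1, every K = ℚ(√-d) (d ≥ 1,
acting on A through φ with φ ≫ φ = -d) and polarization data (t, t') there is ONE integer M such
that at EVERY abelian 2n-fold A reached from a split square B₀ × B₀ (dim B₀ = n; φ₀ = (x, y) ↦ (-d
y, x); Θ₀ = pr₁*P_B + d·pr₂*P_B, h⁰(P_B) = t) by a K-equivariant isogeny g with an effective ample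
P, h⁰(P) = t', g*P ~ N·Θ₀ (N ≥ 1 arbitrary: this sweeps the Hecke/isogeny orbit of the split locus,
Zariski dense in every split-discriminant Weil family), every rational class of the complexified
Weil plane weilClassesOf A φ n d = W_K ⊗ ℂ is supported on a proper intersection D₁ ∩ … ∩ Dₙ of
effective Dᵢ ∈ |kᵢ P| with kᵢ ≤ M — "B_min ≤ M along the whole orbit". OrbitGlue (Chow compactness +
orbit density + isogeny transport + descending) turns X into the shared sector target
WeilClassesAlgebraic (Weil classes algebraic on every abelian variety of Weil type, all K, all 2n ≥
4, all discriminants; = stmt-HodgeConjecture-2522 of route TropicalCuspLift), and two further CRUXES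
carry it to the Statement: OrbitGlue itself (`OrbitDegreeBound → WeilClassesAlgebraic`, a hypothesis
of `closes` with genuine failure modes — density of the orbit as typed, closedness and uniform
cofinality of the bounded-complexity loci) and the last-ranked crux SummitOffWeilSector —
`WeilClassesAlgebraic → HodgeConjecture`, the Hodge conjecture given the sector target, stated over
the shared target decl so that every Weil-class route of the summit attaches to one and the same
item. The negation OrbitDegreeGrowth is filed ranked: the card is two-sided.
Lean: `∀ (n d t t' : ℕ), 1 ≤ n → 0 < d → ∃ M : ℕ, ∀ (B₀ :
Literature.AlgebraicGeometry.Motives.AbelianVariety ℂ) (PB :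
Literature.AlgebraicGeometry.Motives.CartierDivisor B₀.X.left) [AlgebraicGeometry.IsDominant
(Literature.AlgebraicGeometry.Motives.AbelianVariety.Hom.toSchemeHom
(Literature.AlgebraicGeometry.Motives.AbelianVariety.fst B₀ B₀))] [AlgebraicGeometry.IsDominant
(Literature.AlgebraicGeometry.Motives.AbelianVariety.Hom.toSchemeHom
(Literature.AlgebraicGeometry.Motives.AbelianVariety.snd B₀ B₀))], B₀.dim = n → PB.IsAmple →
PB.IsSection 1 → PB.h0 ℂ = t → ∀ (A : Literature.AlgebraicGeometry.Motives.AbelianVariety ℂ) (g :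
B₀.prod B₀ ⟶ A) (φ : A ⟶ A) (P : Literature.AlgebraicGeometry.Motives.CartierDivisor A.X.left) (N :
ℕ) [AlgebraicGeometry.IsDominant
(Literature.AlgebraicGeometry.Motives.AbelianVariety.Hom.toSchemeHom g)],
Literature.AlgebraicGeometry.Motives.AbelianVariety.IsIsogeny g → A.dim = 2 * n →
Literature.AlgebraicGeometry.Motives.IsSmoothProjective (2 * n) A.X → 1 ≤ N →
CategoryTheory.CategoryStruct.comp (Literature.AlgebraicGeometry.Motives.AbelianVariety.prodLift
(-(d • Literature.AlgebraicGeometry.Motives.AbelianVariety.snd B₀ B₀))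
(Literature.AlgebraicGeometry.Motives.AbelianVariety.fst B₀ B₀)) g =
CategoryTheory.CategoryStruct.comp g φ → CategoryTheory.CategoryStruct.comp φ φ = -(d •
CategoryTheory.CategoryStruct.id A) → P.IsAmple → P.IsSection 1 → P.h0 ℂ = t' → (P.pullback
(Literature.AlgebraicGeometry.Motives.AbelianVariety.Hom.toSchemeHom g)).LinEquiv (N • (PB.pullback
(Literature.AlgebraicGeometry.Motives.AbelianVariety.Hom.toSchemeHom
(Literature.AlgebraicGeometry.Motives.AbelianVariety.fst B₀ B₀)) + d • PB.pullback
(Literature.AlgebraicGeometry.Motives.AbelianVariety.Hom.toSchemeHom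
(Literature.AlgebraicGeometry.Motives.AbelianVariety.snd B₀ B₀)))) → ∀ c :
Literature.AlgebraicGeometry.HodgeTheory.complexBetti A.X (2 * n),
Literature.AlgebraicGeometry.HodgeTheory.IsRationalClass c → c ∈
Literature.AlgebraicGeometry.HodgeTheory.weilClassesOf A φ n d → c ∈ ⨆ (D : Fin n →
Literature.AlgebraicGeometry.Motives.CartierDivisor A.X.left) (_ : ∀ i, (D i).IsSection 1 ∧ ∃ k : ℕ,
k ≤ M ∧ (D i).LinEquiv (k • P)) (_ : ∀ z ∈ {z | ∀ i, ¬ (D i).Avoids z}, ((n : ℕ) : ℕ∞) ≤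
Order.coheight z), LinearMap.ker
(Literature.AlgebraicGeometry.HodgeTheory.complexBetti.restrictCompl A.X {z | ∀ i, ¬ (D i).Avoids z}
(2 * n)).hom`
## Assembly
Pure logic, certified natively (lean rc 0, h21_check_closes ok): the deciding theorem is `closes (hX
: OrbitDegreeBound) (hG : OrbitGlue) (hS : SummitOffWeilSector) : HodgeConjecture := hS (hG hX)`
(all three hypotheses are CRUX items: hX the uniform orbit bound X, hG : OrbitGlue =
`OrbitDegreeBound → WeilClassesAlgebraic`, hS : SummitOffWeilSector = `WeilClassesAlgebraic →
HodgeConjecture`; `closes` is crux-only in the sense of D-0027 §2.1 (ii), re-certified 2026-08-16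
after OrbitGlue was re-badged support → crux). The Assembly ITEM is the frame statement #1
`OrbitDegreeBound → HodgeConjecture` ("X suffices"; route-repair ground 2026-08-16 replaced the
earlier three-arrow form, which was literally the type of `closes` and tautological); it is proved
by `fun hX => hS (hG hX)` once OrbitGlue and SummitOffWeilSector are, and it is not a hypothesis of
`closes`. EightfoldOrbitBound, FourfoldOrbitBound and AnchorDegreeBound are literal instances of X
(`eightfold_of_X`, `fourfold_of_X`, `anchor_of_X` — the last at A = B₀ × B₀, g = 𝟙, using φ₀ ≫ φ₀ =
-(d•𝟙)), OrbitDegreeGrowth is its negation; none is a separate hypothesis of `closes`. Typing note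
(route-repair 2026-08-15): effectivity of a Cartier divisor is written `D.IsSection 1` (1 ∈ Γ(X,
𝒪_X(D)), Görtz–Wedhorn I (11.12.3); = `CartierDivisor.isEffective_iff_isSection_one`, definitional),
so the route file imports neither Motives/CartierDivisorEffective nor the barrier file
Barriers/HodgeConjecture/ExceptionalHodgeClasses — its cone carries no unproved Literature fact.
Scope (route-repair 2026-08-16): the route encompasses the whole Statement — its three mechanism
cruxes (OrbitDegreeBound, EightfoldOrbitBound, OrbitDegreeGrowth) reach WeilClassesAlgebraic through
the glue crux OrbitGlue, and the passage from WeilClassesAlgebraic to HodgeConjecture is the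
last-ranked crux SummitOffWeilSector (D-0027 §2.2: a bridge X ⇒ S sits inside a route only together
with its complementary sector as a crux).

Rationale: WHY THIS LINE. Deligne's proof that Hodge classes on abelian varieties are absolute
(Deligne1982HodgeCycles Thm 4.8, §5; CharlesSchnell2014Notes §11.5) uses the split points A₀ ⊗ K as
ANCHORS where Weil classes are algebraic (there they are polynomials in divisor classes — the
mechanism behind AnchorDegreeBound, X at depth one) and transports absoluteness along the Weil
family by Principle B; algebraicity has no Principle B, and this route replaces it by COMPACTNESS:
loci of bounded-degree algebraicity are Zariski closed (proper relative Chow/Hilbert schemes;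
VoisinHodgeII2003 Intro p. 3 "the Hodge conjecture predicts … that Y_λ is the image of a relative
Hilbert scheme", Voisin2007HodgeLoci, CattaniDeligneKaplan1995JAMS), while the K-isogeny orbit of
the anchors is Zariski dense in every split-discriminant component (components with equal invariants
parametrise isogenous varieties, vanGeemen1994HodgeAV §5 and Markman2025SurveySecant §11.5 Step 1;
real approximation for U(n,n); equidistribution of Hecke points doi:10.1007/s002220100126) and
isogenies transport algebraicity (vanGeemen1994HodgeAV 3.7; tree:
mem_algebraicClasses_of_isogeny_of_mem_weilClassesOf). Hence Weil-class algebraicity on the whole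
family is EQUIVALENT to one uniform integer bound on countably many explicit arithmetic varieties
(B₀ × B₀)/G, with no Hodge theory and no deformation theory left in the statement. Imported areas:
arithmetic of Hecke/isogeny orbits (automorphic side); degree geometry of subvarieties of abelian
varieties (Debarre doi:10.24033/bsmf.2236, DebarreEtAl2011, matroidal/tropical lower bounds
arXiv:2507.15704) = NEG engine; theta/Heisenberg and secant-sheaf constructions
(vanGeemen1994HodgeAV 4.16, 5.12; Markman2025SecantWeil) = POS engine; properness of Chow schemes =
transfer principle. What it does that the other Weil-class routes (TropicalCuspLift, HeckePrymWeil,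
NodalThetaWeil, AnchorTransport) do not: nothing is deformed or lifted from an anchor — provers
bound ONE integer invariant at arithmetic points, properness does the spreading — and it carries a
refutation format (divergence along an isogeny tower) naming no non-algebraic class on a single
variety; negatives index empty at filing.

RANKED CRUXES. #0 WeilClassesAlgebraic (target) — the shared sector target
(stmt-HodgeConjecture-2522 verbatim, also wanted by TropicalCuspLift): for n ≥ 2, d ≥ 1, every
complex abelian 2n-fold A with φ ≫ φ = -d, every rational (n,n)-class c = c₁ + c₂ with c₁ ∈ E₊, c₂ ∈
E₋ (the two Weil eigen-lines cut out by the pull-backs (x·𝟙 + y·φ)*) lies in algebraicClasses A.X n;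
vacuous off Weil type. (why it might fail: It IS the Hodge conjecture for Weil classes (imaginary
quadratic K): known for n = 2 (all K, all disc; Markman 2509.23403 Thm 1.2, Floccari–Fu 2504.13607)
and n = 3 split disc (-1)³ only (2502.03415); Weil 1977 proposed the rest (non-split sixfolds, all
2n ≥ 8) as counterexamples.) [Weil1977HodgeRing, vanGeemen1994HodgeAV, Markman2025SurveySecant,
Markman2025SecantWeil, WeilLocusSixfolds2026, Deligne1982HodgeCycles]
#2 OrbitDegreeBound (crux) — X of § Thesis (card item G1, typed over the tree: "degree ≤ B" is
rendered by the support-kernel device of algebraicClasses on proper intersections of members of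
|kP|, k ≤ M, which is cofinal with P-degree by Mumford's degree-e hypersurface generation and
Bézout; effectivity of P_B, P and the Dᵢ is typed `IsSection 1` — 1 ∈ Γ(𝒪(D)), Görtz–Wedhorn I
(11.12.3), = CartierDivisor.isEffective_iff_isSection_one, definitional — so that the statement
rests on Motives/CartierDivisor alone); depth N = 1 is the anchor case (AnchorDegreeBound,
`anchor_of_X`), the first open half-dimension is n = 4. [difficulty: open-problem] (why it might
fail: Mod OrbitGlue it is HC for Weil classes on every split-type 2n-fold, open for n ≥ 4 (Weil 1977
candidates); cycles transported along g have P-degree ~Nⁿ·deg, so bounded cycles must be new at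
every depth, and the one upper-bound engine (secant sheaves) is non-surjective for n ≥ 4 (2502.03415
§1.2).) [Weil1977HodgeRing, Deligne1982HodgeCycles, vanGeemen1994HodgeAV, Markman2025SecantWeil,
Markman2025SurveySecant, Voisin2007HodgeLoci]
#3 EightfoldOrbitBound (crux) — X at n = 4 (literal instance; `eightfold_of_X` in Sketch.lean): the
uniform bound along the isogeny orbit of split squares B₀ × B₀ with dim B₀ = 4. First open rung: by
OrbitGlue it gives the Weil classes on every split-type eightfold and, descending along products
with Weil surfaces of complementary discriminant (Markman2025SurveySecant §11.5 Step 2), on EVERY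
abelian sixfold of Weil type — the live arena (WeilLocusSixfolds2026 §1: non-split sixfolds "resist
all known methods"). [difficulty: open-problem] (why it might fail: n = 4 is Weil's 1977
counterexample range: for imaginary quadratic K no Weil class on a general Weil-type eightfold is
known algebraic; the secant variety is a proper subvariety of P(S⁺) for n ≥ 4 (2502.03415 §1.2) and
the n = 4 Brill–Noether secant sheaves are 'unlikely to be semiregular' (8.2.3).)
[Weil1977HodgeRing, Markman2025SecantWeil, Markman2025SurveySecant, WeilLocusSixfolds2026,
arXiv:2509.23079, vanGeemen1994HodgeAV]
#4 OrbitDegreeGrowth (crux) — NOT-X, the card's refutation branch (G2), filed ranked so that it is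
staffed: for some (n, d, t, t') the minimal complexity of cycles spanning the Weil plane is
unbounded along the isogeny orbit of the split squares. By the Baire converse of compactness this is
equivalent to the failure of Weil-class algebraicity somewhere in that family, i.e. to
¬HodgeConjecture — a counterexample format that exhibits divergence along a tower and never a
non-algebraic class on one variety. Engine: lower bounds for the P-degree of effective cycles with
non-zero Weil component on (B₀ × B₀)/G in terms of |G| (restriction to the images of B₀ × 0, 0 × B₀
and translates, Debarre-type inequalities, pseudoeffective cones, tropical/matroidal
specialisation). [difficulty: XL] (why it might fail: It is ¬X, and HC ⇒ X (Baire: finitely many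
Weil components per (n,d,t,t'), bounded-degree loci closed), so it is false if HC holds; a proof
gives a Hodge counterexample on an abelian variety, i.e. ¬(standard conjecture B) by André 1996 Thm
0.6.2; known degree lower bounds are per-variety/integral.) [Andre1996Motifs,
doi:10.24033/bsmf.2236, DebarreEtAl2011, arXiv:2507.15704, Zharkov2020TropicalWeil,
KollarTrento1992]
#5 OrbitGlue (crux; the glue of the line, a hypothesis of `closes`, re-badged support → crux
2026-08-16 under D-0027 §2.1 (ii) because it is unproved and not routine in fact) — X →
WeilClassesAlgebraic. Ingredients, each in print: (i) COMPACTNESS — over each component S of the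
polarized Weil moduli (fine level) the locus D_M of points whose Weil plane lies in the bounded span
is Zariski closed (bounded-degree relative Chow schemes are proper with finitely many components;
cycle classes are locally constant; two flat sub-local-systems agree on a connected set iff at one
point), so D_M ⊇ dense orbit forces D_M = S; (ii) DENSITY — split squares have discriminant (-1)ⁿ =
the split class (Deligne–Milne Cor. 4.2; tree WeilDiscriminantSplit), components with equal (K, 2n,
disc, type) parametrise isogenous varieties (vanGeemen1994HodgeAV §5, Markman2025SurveySecant §11.5
Step 1), U(n,n)(ℚ) dense in U(n,n)(ℝ); (iii) TRANSPORT along isogenies (tree: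
mem_algebraicClasses_of_isogeny_of_mem_weilClassesOf); (iv) COFINALITY of the |kP|-tuple complexity
with P-degree (3P very ample, Mumford's set-theoretic generation in degree deg, Bertini off the base
locus); (v) DESCENDING 2n+2 split ⇒ 2n every discriminant by products with Weil surfaces
(Markman2025SurveySecant §11.5 Step 2, Schoen1998HodgeWeilAddendum §10; tree WeilClassesProducts)
and Weil polarizations exist (vanGeemen1994HodgeAV 5.2 (1); tree WeilTypePolarization); (vi) the
Baire converse (HC on S ⇒ some D_M = S) used by FourfoldOrbitBound and OrbitDegreeGrowth. Formal
proof needs the universal Weil family and relative Chow schemes on real carriers (absent): restate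
with named-fact hypotheses as they are vendored. [difficulty: L] (why it might fail: needs (a)
Zariski density of the orbit AS TYPED (g*P ∈ ℕ·Θ₀, fixed h⁰-types) in each split-discriminant Weil
component, (b) closedness of the bounded-complexity loci — relative Chow plus cofinality of
|kP|-tuples with degree, UNIFORM over the family, (c) descending to every discriminant; (a)/(b) may
fail for X as typed — KILL CRITERIA (ii)/(iii).) [CattaniDeligneKaplan1995JAMS, VoisinHodgeII2003,
Voisin2007HodgeLoci, vanGeemen1994HodgeAV, Markman2025SurveySecant, Schoen1998HodgeWeilAddendum,
Mumford1966, doi:10.1007/s002220100126]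
#6 SummitOffWeilSector (crux, ranked last) — FROM THE WEIL SECTOR TO THE SUMMIT (route-repair
2026-08-16): `WeilClassesAlgebraic → HodgeConjecture`, the Hodge conjecture for every smooth
projective complex variety GIVEN the shared sector target, stated over that decl so that every
Weil-class route (TropicalCuspLift, HeckePrymWeil, NodalThetaWeil, …) attaches to one item (it
supersedes the inlined frame stmt-HodgeConjecture-2528). The orbit mechanism ends at
WeilClassesAlgebraic; this crux is the route's fifth research obstruction and completes the cover of
the Statement (D-0027 §2.2: a bridge X ⇒ S sits inside a route only together with its complementary
sector as a crux). Exact status (cf. Theorems/SummitOffWeilSector/Negative/ConjectureGrade.lean for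
its HeckePrymWeil twin): HodgeConjecture → it; ¬it ↔ (WeilClassesAlgebraic ∧ ¬HodgeConjecture) — a
refutation is a disproof of the Clay problem, a proof is HC from the Weil sector; vetting records
that and moves on. Partial glue lands `--supports`: (a) Weil classes for ALL CM fields ⇒ HC for CM
abelian varieties (Andre1992HodgeCM; Abdulali2005CMHodge Thm 4) — this consumes Weil classes for CM
fields of every degree, not only the imaginary quadratic K of WeilClassesAlgebraic; (b) HC for
abelian varieties of dimension ≤ 5 from the n = 2 sector (Markman2025SurveySecant Cor. 1.3); (c)
Kuga–Satake-type transfers. [deps: WeilClassesAlgebraic] [difficulty: open-problem] (why it might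
fail: it is HC for everything else — non-abelian varieties (no reduction to abelian ones beyond
Kuga–Satake), non-CM abelian varieties, Weil classes for CM fields of degree > 2; HC fails for
Kähler manifolds (Voisin 2002) and integrally, so it may be false.) [Deligne2000, Andre1992HodgeCM,
Abdulali2005CMHodge, MoonenZarhin1998WeilClasses, Voisin2002KaehlerCounterexample,
Markman2025SurveySecant]
#9 FourfoldOrbitBound (support) — X at n = 2 (literal instance; `fourfold_of_X` in Sketch.lean) —
CALIBRATION. True non-effectively: Weil classes on every abelian fourfold of Weil type are algebraic
(tree fact Markman2025_weilClasses_algebraic_abelianFourfold = Markman2025SurveySecant Thm 1.2 +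
§11.5 Step 2), so each of the finitely many components with data (d, t, t') is a countable
increasing union of closed D_M; Baire gives one M. The EFFECTIVE M at the first deep points (isogeny
degree p, p²) of van Geemen's ℚ(i) family (vanGeemen1994HodgeAV 5.12: explicit B₀, theta cycles
4.16; Markman's secant-sheaf supports have computable degree) is the card's computation G3 — the
first number this line can own: attach kit jobs / certified computations here (evidence kind
computation); every NEG lower-bound technique is tested here (it must NOT diverge). [difficulty: M]
[Markman2025SurveySecant, Markman2025SecantWeil, vanGeemen1994HodgeAV, Schoen1988HodgeWeil]
#9 AnchorDegreeBound (support) — X AT DEPTH ONE — the anchors themselves (literal instance of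
OrbitDegreeBound at A = B₀ × B₀, g = 𝟙, φ = φ₀ = prodLift(-d·snd, fst); `anchor_of_X :
OrbitDegreeBound → AnchorDegreeBound` in Sketch.lean, via φ₀ ≫ φ₀ = -(d•𝟙) and 𝟙^*P = P): for every
(n, d, t, t') ONE M such that on every split square B₀ × B₀ (dim B₀ = n; P_B ample, effective, h⁰ =
t) and every effective ample P ~ N·Θ₀ (N ≥ 1, h⁰(P) = t') every rational class of weilClassesOf (B₀
× B₀) φ₀ n d is supported on a proper intersection of n effective Dᵢ ~ kᵢ·P, kᵢ ≤ M. FREE ANCHORS /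
CALIBRATION OF THE TYPING — here HC costs nothing: W_K = det(H¹(B₀) ⊗ K) is SL(H¹(B₀))-invariant and
the Sp(H¹(B₀), ψ)-invariants of Λ(H¹ ⊕ H¹) are generated by the degree-2 invariants ψ₁₁, ψ₂₂, ψ₁₂ =
c₁(pr₁*L), c₁(pr₂*L), c₁(m*L − pr₁*L − pr₂*L) (first fundamental theorem for Sp / skew Howe duality,
GoodmanWallachGTM255), so the Weil plane lies in the divisor ring Dⁿ of B₀ × B₀
(vanGeemen1994HodgeAV §2.4 and Thm 4.3-type argument, Deligne1982HodgeCycles §4–5; sanity n = 1: W ⊂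
NS(E × E)_ℚ = ⟨E × 0, 0 × E, Δ⟩); Bertini/moving (D + 3Θ₀ very ample on every abelian variety,
LangeBirkenhake1992 §4.5) rewrites divisor monomials as ℚ-combinations of classes of proper
intersections of effective members of |jΘ₀|, j ≤ M₁(n, d, t), and for P ~ N·Θ₀ each Dᵢ ∈ |jΘ₀| is
padded by a general member of |(jN − j)Θ₀| (supports and kernels only grow, properness by Bertini),
so one M serves every N; the one non-formal point is UNIFORMITY of M over the moduli of (B₀, P_B) of
type t (finitely many components: constructibility + Baire, or an explicit invariant-theory bound).
Supersedes SplitSquareAnchors (stmt-HodgeConjecture-12684: same content, typed with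
`divisorClassesSpan` of Barriers/HodgeConjecture/ExceptionalHodgeClasses, which pulled two XL
barrier facts into the cone). A refutation here refutes X through its TYPING (KILL CRITERIA (ii)),
not the line. [deps: OrbitDegreeBound] [difficulty: M] [vanGeemen1994HodgeAV,
Deligne1982HodgeCycles, GoodmanWallachGTM255, LangeBirkenhake1992, VoisinHodgeI2002]

TWO-LAYER PLAN. Foreseen glued splits (none filed now): OrbitDegreeBound ⇐ PrimeDepthBound (N prime
suffices: prime Hecke translates of the split locus are already dense, doi:10.1007/s002220100126) →
OneStepPropagation (a bound at depth N·p from a bound at depth N with controlled loss) →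
OrbitDegreeBound; OrbitGlue ⇐ Compactness (D_M closed) → OrbitDensity → Descending (k = 3);
OrbitDegreeGrowth ⇐ LowDegreeRigidity (for n = 4 every effective cycle of P-degree ≤ B on (B₀ ×
B₀)/G with |G| ≫_B 1 is numerically a combination of transported cycles and P-powers) → Divergence.

KILL CRITERIA. (i) OrbitDegreeGrowth proved, or divergence certified along one explicit tower: close
the positive line `refuted:OrbitDegreeBound`; by the Baire converse this is ¬WeilClassesAlgebraic,
to be filed as a refutation of the summit (operator). (ii) FourfoldOrbitBound refuted: contradicts
Markman 2025 + compactness, so the TYPING (cofinality of the |kP|-tuple complexity with degree, or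
the LinEquiv/h⁰ bookkeeping of the orbit) is wrong — restate X over a degree notion (definition
request below) via a repaired item, or close `refuted:FourfoldOrbitBound` if no restatement
survives. (ii') Likewise AnchorDegreeBound refuted (depth one, where the Weil plane provably lies in
the divisor ring): the typing is wrong at the anchors themselves (cofinality, the N-padding, or
uniformity over the moduli of (B₀, P_B)) — restate X via a repaired item, never close on it alone.
(iii) A refuter showing the orbit as typed (g*P ~ N·Θ₀ exactly) is NOT Zariski dense in some split
component forces a restatement of the polarization clause, not a close. (iv) WeilClassesAlgebraic
proved by another route (TropicalCuspLift, HeckePrymWeil, NodalThetaWeil, AnchorTransport) ⇒ close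
superseded. (v) Dormant if, once the n = 2 calibration numbers are in, neither a non-transported
uniform construction for n = 4 nor a rational lower-bound engine is in sight. (vi)
SummitOffWeilSector refuted — i.e. WeilClassesAlgebraic ∧ ¬HodgeConjecture (cf.
Theorems/SummitOffWeilSector/Negative/ConjectureGrade), a negative decision of the summit itself:
the route closes `refuted:SummitOffWeilSector`; what is proved at or below WeilClassesAlgebraic (X,
OrbitGlue, the rungs) stays in Theorems as sector results.

NOT DECOMPOSED YET. Prime depth and the one-step propagation lemma (children of OrbitDegreeBound);
the compactness / density / descending children of OrbitGlue (need relative Chow schemes and the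
universal Weil family on real carriers); direct anchors (B₀' × B₀') × (E × E') of arbitrary
discriminant, which would remove descending; the CM-field version (anchors B₀ ⊗ O_E on unitary
Shimura varieties for CM fields E) which with Andre1992HodgeCM (CharlesSchnell2014Notes Thm 11.5.21)
would split SummitOffWeilSector into a routine CM-abelian part and the foreign rest (non-CM abelian,
non-abelian) — SummitOffWeilSector stays a single crux until a mechanism crux closes; explicit
low-degree rigidity statements on (B₀ × B₀)/G for the NEG side; the divisorial sharpening of the
retired DegreeSpectroscopy route (bounded divisor MONOMIALS along the orbit — expected false, a
lattice-arithmetic toy) kept as a layer-2 experiment, not an item.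

CHEAPEST FALSIFIER. (1) The n = 1 toy, decidable by lattice arithmetic: surfaces isogenous to E₀ ×
E₀ with K ⊂ End⁰, W_K ⊂ NS; compute the minimal P-degree of effective representatives of the Weil
line along an isogeny tower (ternary/quaternary forms à la Kani) — X(1) must hold (Lefschetz); this
checks the (t, t', N, LinEquiv) bookkeeping and the cofinality constants of the typing. (2) n = 2, K
= ℚ(i): B_min at the first split points of isogeny degree p, p² of van Geemen's family (5.12) from
theta cycles and secant-sheaf supports — must stay bounded (Markman); a NEG technique that diverges
here is wrong. (3) Lookup (2026-08-15, § Novelty): no printed "HC on a Shimura family ⟺ uniform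
degree bound along one Hecke orbit" nor the divergence format was found; if one exists in the
unlikely-intersection / equidistribution literature the grade drops to known, the route stands.

NUMBERS. Known: n = 2, all K, all discriminants (Markman2025SurveySecant Thm 1.2, Cor. 1.3: HC for
abelian varieties of dimension ≤ 5; tree fact Markman2025_weilClasses_algebraic_abelianFourfold); n
= 3 only disc -1 = (-1)³, the split class (Markman2025SecantWeil Thm 1.5.1; Deligne–Milne Cor. 4.2:
split squares have disc (-1)ⁿ, tree WeilDiscriminantSplit); open: n = 3 other discriminants, every n
≥ 4 (WeilLocusSixfolds2026 §1). Bookkeeping: for g*P ~ N·Θ₀, deg_P(g_*Z) = Nⁿ·deg_Θ₀(Z) and P^(2n) =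
(2n)!·t'; a component of a proper intersection of n members of |kᵢP|, kᵢ ≤ M, has P-degree ≤
Mⁿ·(2n)!·t'; conversely a subvariety of 3P-degree e is a component of a proper intersection of n
members of |3eP|. Route-repair 2026-08-15 (cone): the 3 unproved facts of the import cone
(`CartierDivisor.IsEffective`, a predicate misread as cite-only; the XL barrier facts
Weil1977_/Mumford1968_exceptionalHodgeClasses riding in with `divisorClassesSpan`) were used by no
item — effectivity re-typed `IsSection 1`, SplitSquareAnchors superseded by AnchorDegreeBound;
imports: Statement, HodgeTheory/WeilClasses, Motives/AbelianVarietyProduct,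
Motives/CartierDivisorClassPullback, DiophantineGeometry/AVIsogenyQuasiInverse (instance
`isIntegral_left`); cone 87 → 48 modules. Route-repair 2026-08-16 (gate stamp): SummitOffWeilSector
restated over the target decl (meaning unchanged: the old statement inlined WeilClassesAlgebraic)
and re-badged support → crux, ranked last (stmt-HodgeConjecture-14189); the Assembly item restated
as the frame #1 `OrbitDegreeBound → HodgeConjecture` (stmt-HodgeConjecture-14501; the three-arrow
form was the type of `closes`, ground.trivial); `closes` keeps its shape hS (hG hX). Route-repair
2026-08-16 (gen 2/3, crux-only deciding theorem): OrbitGlue re-badged support → crux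
(stmt-HodgeConjecture-12682; it is a hypothesis of `closes`), `closes` re-certified crux-only
(native OK). Items now: 9 active — 1 target; 5 cruxes (OrbitDegreeBound 2, EightfoldOrbitBound 3,
OrbitDegreeGrowth 4, then OrbitGlue and SummitOffWeilSector, both ranked last); 2 support
(FourfoldOrbitBound, AnchorDegreeBound: literal instances of X); 1 assembly (frame #1).

DEFINITION REQUESTS. - cycleDegreeSpan (Literature/AlgebraicGeometry/HodgeTheory): for a smooth
projective X over ℂ, an ample Cartier divisor P and δ, p : ℕ, the ℂ-span in H²ᵖ(X(ℂ); ℂ) of the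
classes of integral codimension-p subvarieties of P-degree ≤ δ — lets X be restated literally as
"B_min ≤ M" and OrbitGlue (iv) be dropped; filed after open (`ledger workitem add --kind
definition`).
- Relative cycle spaces / the universal polarized Weil family on real carriers
(Literature/AlgebraicGeometry/Motives): properness of bounded-degree relative Chow schemes — the
compactness child of OrbitGlue. Cite facts wanted later: equidistribution of Hecke points
(doi:10.1007/s002220100126), Mumford's degree-deg set-theoretic generation.
- divisorMonomials / divisorClassesSpan (van Geemen §2.4's Dᵐ ⊗ ℂ) re-housed in
Literature/AlgebraicGeometry/HodgeTheory (today inside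
Barriers/HodgeConjecture/ExceptionalHodgeClasses, whose two XL unproved barrier facts then enter any
cone naming the divisor ring); once moved, the divisor-ring form of the anchors (ex
SplitSquareAnchors) can be re-filed as support.

Novelty: Searches (2026-08-15): `lit search --hybrid "bounded degree algebraic cycles Hodge locus countable
union closed subvarieties Chow variety Hodge conjecture"` (12 book hits — VoisinHodgeII2003 PDF pp.
40–41, 104–107; Cattani–El Zein–Griffiths–Lê 2014; Kerr–Pearlstein 2016: the folklore only); `lit
frontier HodgeConjecture --since 2022` (30 rows; relevant arXiv:2603.20268, arXiv:2606.08882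
"Algebraic Hodge generic points are dense", arXiv:2603.22171); `lit bridges HodgeConjecture --cross
any` (30 rows, none relevant); `lit search --source crossref "Hecke operators equidistribution of
Hecke points"` (doi:10.1007/s002220100126, doi:10.1515/form.2003.009,
doi:10.1017/s0143385705000428); `lit search --source crossref "Debarre degrees of curves in abelian
varieties"` (doi:10.24033/bsmf.2236); `lit galaxy search "abelian varieties of Weil type" --star
all` (3 rows: LNM 1594, Kerr–Pearlstein, Mumford Selecta) and `"equidistribution of Hecke points"
--star all` (12 rows, no cycle-degree content); plus the card's eight refuter novelty audits (zbMATH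
sweeps: no printed equivalence for Shimura families, no divergence format; nearest rational
bookkeeping DebarreEtAl2011, Fulger–Lehmann arXiv:1408.5154).
Nearest prior art found: Deligne1982HodgeCycles Thm 4.8/§5 = CharlesSchnell2014Notes Thm 11.5.24
(the SAME anchors A₀ ⊗ K, with Principle B, for absolute Hodge classes); VoisinHodgeII2003 Intro p.
3 + Voisin2007HodgeLoci + CattaniDeligneKaplan1995JAMS (HC ⇒ a Hodge-locus component is the ima  [refs: 10.1007/s002220100126, 10.1515/form.2003.009, 10.1017/s0143385705000428, 10.24033/bsmf.2236, 2603.20268, 2606.08882, 2603.22171, 1408.5154, 2507.15704, doi:10.1007/s002220100126, doi:10.1515/form.2003.009, doi:10.1017/s0143385705000428, doi:10.24033/bsmf.2236, VoisinHodgeII2003, DebarreEtAl2011]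

Barriers (technique_class: chow-compactness, degree-bounds, hecke-density, weil-classes): - technique_class: chow-compactness, degree-bounds, hecke-density, weil-classes
- Literature.Barriers.HodgeConjecture.Andre1996_hodgeClassesOnAbelianVarieties_motivated: the POS
side (OrbitDegreeBound, EightfoldOrbitBound) constructs/bounds cycles and is untouched; the NEG side
is a divergence statement along a tower — it exhibits no Hodge class on a single abelian variety, so
motivated-ness of every Weil class is consistent with it; the price (a proof of OrbitDegreeGrowth
gives ¬B(X) for an auxiliary X, André 0.6.2, cf.
not_hodgeCounterexampleOnAbelianVariety_of_lefschetzStandardConjecture) is stated on the item.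
- Literature.Barriers.HodgeConjecture.hodgeClassesAreAbsoluteFor_abelianVariety: no Galois or
conjugation test is used; at every orbit point the Weil classes ARE algebraic (isogeny transport)
and only their degree is measured — a quantity absoluteness does not see.
- Literature.Barriers.HodgeConjecture.Weil1977_exceptionalHodgeClasses: the targeted classes are
exactly the exceptional ones; divisor classes enter only as the yardstick |kP| and POINTWISE at
orbit points, where the Weil plane provably lies in the divisor ring (SplitSquareAnchors +
transport, NS of rank 3), never at the generic point where B¹ = ℚ; the passage to the generic point
is by compactness, not by generation in degree 2.
- Literature.Barriers.HodgeConjecture.Mumford1968_simpleFourfold_exceptionalHodgeClasses: same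
evasion; for n = 2 the statement is moreover a theorem (FourfoldOrbitBound is calib

History (route lifecycle, newest last):
- 2026-08-15T19:35:38Z · rev 2: restated OrbitDegreeBound (stmt-HodgeConjecture-12679), EightfoldOrbitBound (stmt-HodgeConjecture-12680), FourfoldOrbitBound (stmt-HodgeConjecture-12683), SplitSquareAnchors (stmt-HodgeConjecture-12684) — route-repair (cone, planner rrepair 2026-08-15): re-route AROUND the 3 unproved facts of the import cone — n (planner-rrepair-HodgeConjecture-HeckeOrbitComp-9bb2064d-0)
- 2026-08-16T03:07:02Z · rev 4: restated SummitOffWeilSector (stmt-HodgeConjecture-2528) — route-repair (partial-claim hold, planner rbadge 2026-08-16), part 2 after the re-badge of rev 3: SummitOffWeilSector (now crux) restated over the target decl ( (planner-rbadge-HodgeConjecture-HeckeOrbitCompa-9bb2064d-0)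
- 2026-08-26T19:37:46Z · DORMANT — reconciler: no traction for 5 d (last activity item-evidence-added at 2026-08-21T18:49:17Z); parked, not closed — `ledger route dormant route-HodgeConjecture-He (operator:999:2697925)

sub-problem: HodgeConjecture · status: dormant · opened planner-plancard-HodgeConjecture-HodgeConject-084f5d2e-g2-0 2026-08-15T18:56:05Z · rev 13 · ledger route-HodgeConjecture-HeckeOrbitCompactness
GENERATED by the gate from the ledger (D-0016/17). Provers cite these decls: `theorem foo : Summit.HodgeConjecture.HodgeConjecture.Theses.HeckeOrbitCompactness.<Decl> := …` in Summits/HodgeConjecture/HodgeConjecture/Theorems/<Name>.lean.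
-/

namespace Summit.HodgeConjecture.HodgeConjecture.Theses.HeckeOrbitCompactness

open scoped BigOperators Topology Manifold Classical MeasureTheory ProbabilityTheory Matrix InnerProductSpace ComplexConjugate ContinuousMap
open Filter Set Function TopologicalSpace MeasureTheory

attribute [summit_statement] _root_.HodgeConjecture

/-- item stmt-HodgeConjecture-2522 · target · rank 0 · open · by planner
why it might fail: It IS the Hodge conjecture for Weil classes (imaginary quadratic K): known for n = 2 (all K, all disc; Markman 2509.23403 Thm 1.2, Floccari–Fu 2504.13607) and n = 3 split disc (-1)³ only (2502.03415); Weil 1977 proposed the rest (non-split sixfolds, all 2n ≥ 8) as counterexamples.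
sources: Weil1977HodgeRing, vanGeemen1994HodgeAV, Markman2025SurveySecant, Markman2025SecantWeil, WeilLocusSixfolds2026, Deligne1982HodgeCycles
[target] Thesis X: Weil classes are algebraic in every dimension 2n ≥ 4. Data: A abelian over ℂ of
dim 2n, φ : A ⟶ A with φ ≫ φ = -d (so K = ℚ(√-d) ↪ End⁰A). E_ε (ε = ±1) := {c ∈ H^{2n}(A(ℂ);ℂ) | ∀ x
y : ℕ, (x + yφ)^* c = (x + ε·i·y·√d)^{2n} c}; since (ψ₁+ψ₂)^* is additive on H¹ of an abelian
variety and H^{2n} = ⋀^{2n}H¹ as a φ^*-representation, E_ε = ⋀^{2n}(ε i√d-eigenspace of φ^* on H¹)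
is a line (the characters (x+iy√d)^a (x−iy√d)^b, a+b = 2n, are pairwise distinct polynomials in x,y)
and E_+ ⊕ E_- = W_K ⊗ ℂ is the complexified 2-plane of Weil classes (Geemen1994 §4,
Deligne1982HodgeCycles §4). Statement: every c rational and of Hodge type (n,n) with c = c₁ + c₂, c₁
∈ E_+, c₂ ∈ E_-, lies in algebraicClasses A.X n. If (A,φ) is not of signature (n,n), E_± have Hodge
types (a,b),(b,a) with a ≠ b and the only rational (n,n)-class in E_+ + E_- is 0 (vacuous there, as
it should be). Known cases: n = 2 all K and all discriminants (Markman2025SecantWeil,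
arXiv:2509.23079; earlier Schoen, van Geemen, Koike, Markman's generalized Kummers), n = 3 with disc
≡ -1 (arXiv:2502.03415, all K), n = 3 K = ℚ(√-3) trivial disc (Schoen); everything else open.
Consequences: HC for CM abelian varietie -/
@[route_item "route-HodgeConjecture-HeckeOrbitCompactness"]
def WeilClassesAlgebraic : Prop :=
  ∀ (n : ℕ), 2 ≤ n → ∀ (d : ℕ), 0 < d → ∀ (A : Literature.AlgebraicGeometry.Motives.AbelianVariety ℂ) (φ : A ⟶ A), A.dim = 2 * n → Literature.AlgebraicGeometry.Motives.IsSmoothProjective (2 * n) A.X → CategoryTheory.CategoryStruct.comp φ φ = -(d • CategoryTheory.CategoryStruct.id A) → ∀ c : Literature.AlgebraicTopology.SingularHomology.singularCohomology ℂ ℂ (Literature.AlgebraicGeometry.Motives.ComplexPoints A.X) (2 * n), Literature.AlgebraicGeometry.HodgeTheory.IsRationalClass c → Literature.AlgebraicGeometry.HodgeTheory.IsOfHodgeType (2 * n) A.X (2 * n) n n c → (∃ c₁ c₂ : Literature.AlgebraicTopology.SingularHomology.singularCohomology ℂ ℂ (Literature.AlgebraicGeometry.Motives.ComplexPoints A.X)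 (2 * n), c = c₁ + c₂ ∧ (∀ x y : ℕ, Literature.AlgebraicTopology.SingularHomology.singularCohomology.map ℂ ℂ (Literature.AlgebraicGeometry.Motives.AlgPoints.mapContinuous (L := ℂ) (x • CategoryTheory.CategoryStruct.id A + y • φ).hom.hom.hom) (2 * n) c₁ = ((x : ℂ) + (y : ℂ) * Complex.I * (Real.sqrt d : ℂ)) ^ (2 * n) • c₁) ∧ (∀ x y : ℕ, Literature.AlgebraicTopology.SingularHomology.singularCohomology.map ℂ ℂ (Literature.AlgebraicGeometry.Motives.AlgPoints.mapContinuous (L := ℂ) (x • CategoryTheory.CategoryStruct.id A + y • φ).hom.hom.hom) (2 * n) c₂ = ((x : ℂ) - (y : ℂ) * Complex.I * (Real.sqrt d : ℂ)) ^ (2 * n) • c₂)) → c ∈ Literature.AlgebraicGeometry.HodgeTheory.algebraicClasses A.X n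

-- earlier OrbitDegreeBound (stmt-HodgeConjecture-12679, replaced 2026-08-15T19:35:38Z -> stmt-HodgeConjecture-13689): retired by None — ∀ (n d t t' : ℕ), 1 ≤ n → 0 < d → ∃ M : ℕ, ∀ (B₀ : Literature.AlgebraicGeometry.Motives.AbelianVariety ℂ) (PB : Literature.AlgebraicGeometry.Motives.CartierDivisor B₀.X.left) [AlgebraicGeometry.IsDominant (Literature.AlgebraicGeometry.Motives.AbelianVariety.Hom.toSc
/-- item stmt-HodgeConjecture-13689 · crux · rank 2 · open · by planner
why it might fail: Mod OrbitGlue it is HC for Weil classes on every split-type 2n-fold, open for n ≥ 4 (Weil 1977 candidates); cycles transported along g have P-degree ~Nⁿ·deg, so bounded cycles must be new at every depth, and the one upper-bound engine (secant sheaves) is non-surjective for n ≥ 4 (2502.03415 §1.2).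
sources: Weil1977HodgeRing, Deligne1982HodgeCycles, vanGeemen1994HodgeAV, Markman2025SecantWeil, Markman2025SurveySecant, Voisin2007HodgeLoci
[crux] X of § Thesis (card item G1, typed over the tree: "degree ≤ B" is rendered by the
support-kernel device of algebraicClasses on proper intersections of members of |kP|, k ≤ M, which
is cofinal with P-degree by Mumford's degree-e hypersurface generation and Bézout; effectivity of
P_B, P and the Dᵢ is typed `IsSection 1` — 1 ∈ Γ(𝒪(D)), Görtz–Wedhorn I (11.12.3), =
CartierDivisor.isEffective_iff_isSection_one, definitional — so that the statement rests on
Motives/CartierDivisor alone); depth N = 1 is the anchor case (AnchorDegreeBound, `anchor_of_X`),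
the first open half-dimension is n = 4. [difficulty: open-problem] -/
@[route_item "route-HodgeConjecture-HeckeOrbitCompactness", crux]
def OrbitDegreeBound : Prop :=
  ∀ (n d t t' : ℕ), 1 ≤ n → 0 < d → ∃ M : ℕ, ∀ (B₀ : Literature.AlgebraicGeometry.Motives.AbelianVariety ℂ) (PB : Literature.AlgebraicGeometry.Motives.CartierDivisor B₀.X.left) [AlgebraicGeometry.IsDominant (Literature.AlgebraicGeometry.Motives.AbelianVariety.Hom.toSchemeHom (Literature.AlgebraicGeometry.Motives.AbelianVariety.fst B₀ B₀))] [AlgebraicGeometry.IsDominant (Literature.AlgebraicGeometry.Motives.AbelianVariety.Hom.toSchemeHom (Literature.AlgebraicGeometry.Motives.AbelianVariety.snd B₀ B₀))], B₀.dim = n → PB.IsAmple → PB.IsSection 1 → PB.h0 ℂ = t → ∀ (A : Literature.AlgebraicGeometry.Motives.AbelianVariety ℂ) (g : B₀.prod B₀ ⟶ A) (φ : A ⟶ A) (P : Literature.AlgebraicGeometry.Motives.CartierDivisor A.X.left) (N : ℕ) [AlgebraicGeometry.IsDominant (Literature.AlgebraicGeometry.Motives.AbelianVariety.Hom.toSchemeHom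 g)], Literature.AlgebraicGeometry.Motives.AbelianVariety.IsIsogeny g → A.dim = 2 * n → Literature.AlgebraicGeometry.Motives.IsSmoothProjective (2 * n) A.X → 1 ≤ N → CategoryTheory.CategoryStruct.comp (Literature.AlgebraicGeometry.Motives.AbelianVariety.prodLift (-(d • Literature.AlgebraicGeometry.Motives.AbelianVariety.snd B₀ B₀)) (Literature.AlgebraicGeometry.Motives.AbelianVariety.fst B₀ B₀)) g = CategoryTheory.CategoryStruct.comp g φ → CategoryTheory.CategoryStruct.comp φ φ = -(d • CategoryTheory.CategoryStruct.id A) → P.IsAmple → P.IsSection 1 → P.h0 ℂ = t' → (P.pullback (Literature.AlgebraicGeometry.Motives.AbelianVariety.Hom.toSchemeHom g)).LinEquiv (N • (PB.pullback (Literature.AlgebraicGeometry.Motives.AbelianVariety.Hom.toSchemeHom (Literature.AlgebraicGeometry.Motives.AbelianVariety.fst B₀ B₀)) + d • PB.pullback (Literature.AlgebraicGeometry.Motives.AbelianVariety.Hom.toSchemeHom (Literature.AlgebraicGeometry.Motives.AbelianVariety.snd B₀ B₀)))) → ∀ c : Literature.AlgebraicGeometry.HodgeTheory.complexBetti A.X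 (2 * n), Literature.AlgebraicGeometry.HodgeTheory.IsRationalClass c → c ∈ Literature.AlgebraicGeometry.HodgeTheory.weilClassesOf A φ n d → c ∈ ⨆ (D : Fin n → Literature.AlgebraicGeometry.Motives.CartierDivisor A.X.left) (_ : ∀ i, (D i).IsSection 1 ∧ ∃ k : ℕ, k ≤ M ∧ (D i).LinEquiv (k • P)) (_ : ∀ z ∈ {z | ∀ i, ¬ (D i).Avoids z}, ((n : ℕ) : ℕ∞) ≤ Order.coheight z), LinearMap.ker (Literature.AlgebraicGeometry.HodgeTheory.complexBetti.restrictCompl A.X {z | ∀ i, ¬ (D i).Avoids z} (2 * n)).hom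

/-- item stmt-HodgeConjecture-17825 · crux · rank 2 · open · by planner
why it might fail: X's open core in non-vanishing form: for n ≥ 4 no bounded-complexity cycle with non-zero Weil coordinates is known deep in the orbit — transports have P-degree ~Nⁿ·deg, secant-sheaf classes miss the Weil plane generically for n ≥ 4 (2502.03415 §1.2); Weil 1977 expects bounded cycles Weil-orthogonal.
sources: Weil1977HodgeRing, vanGeemen1994HodgeAV, Markman2025SecantWeil, Markman2025SurveySecant, Deligne1982HodgeCycles
[crux] CHILD 1 of OrbitDegreeBound (K-saturation split = BC2 redirect of the RESTATED deciding crux,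
crux-strategist 2026-08-17). ONE BOUNDED WEIL SEED PER ORBIT POINT: for every (n, d, t, t') ONE
integer M such that at every abelian 2n-fold A of the K-isogeny orbit of the split squares B₀ × B₀
(same binders as OrbitDegreeBound: g : B₀ × B₀ ⟶ A a K-equivariant isogeny, φ ≫ φ = -d, P ample
effective with h⁰ = t', g*P ~ N·Θ₀) there is ONE class c of H²ⁿ(A(ℂ); ℂ) lying in the Weil plane
W(A, φ) = E₊ ⊔ E₋ but on NEITHER eigen-line (c ∉ E₊, c ∉ E₋ — both Weil coordinates non-zero) and in
SUPP_M(A, P), the span of the classes supported on proper intersections D₁ ∩ … ∩ Dₙ of effective Dᵢ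
∈ |kᵢP|, kᵢ ≤ M. No rationality and no Hodge type in the statement: it is the non-vanishing form in
which both engines of the route operate (POS: one theta/secant/transported-and-intersected cycle
with non-zero Weil coordinates, a single character computation, van Geemen 4.16 / Markman's Chern
characters; NEG: all bounded cycles Weil-orthogonal deep in the tower), it is invariant under Aut(ℂ)
and makes sense in any Weil cohomology (ℓ-adic transfer to supersingular reductions, where Weil
classes are algebr -/
@[route_item "route-HodgeConjecture-HeckeOrbitCompactness", crux]
def OrbitWeilSeed : Prop :=
  ∀ (n d t t' : ℕ), 1 ≤ n → 0 < d → ∃ M : ℕ, ∀ (B₀ : Literature.AlgebraicGeometry.Motives.AbelianVariety ℂ) (PB : Literature.AlgebraicGeometry.Motives.CartierDivisor B₀.X.left) [AlgebraicGeometry.IsDominant (Literature.AlgebraicGeometry.Motives.AbelianVariety.Hom.toSchemeHom (Literature.AlgebraicGeometry.Motives.AbelianVariety.fst B₀ B₀))] [AlgebraicGeometry.IsDominant (Literature.AlgebraicGeometry.Motives.AbelianVariety.Hom.toSchemeHom (Literature.AlgebraicGeometry.Motives.AbelianVariety.snd B₀ B₀))], B₀.dim = n → PB.IsAmple → PB.IsSection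 1 → PB.h0 ℂ = t → ∀ (A : Literature.AlgebraicGeometry.Motives.AbelianVariety ℂ) (g : B₀.prod B₀ ⟶ A) (φ : A ⟶ A) (P : Literature.AlgebraicGeometry.Motives.CartierDivisor A.X.left) (N : ℕ) [AlgebraicGeometry.IsDominant (Literature.AlgebraicGeometry.Motives.AbelianVariety.Hom.toSchemeHom g)], Literature.AlgebraicGeometry.Motives.AbelianVariety.IsIsogeny g → A.dim = 2 * n → Literature.AlgebraicGeometry.Motives.IsSmoothProjective (2 * n) A.X → 1 ≤ N → CategoryTheory.CategoryStruct.comp (Literature.AlgebraicGeometry.Motives.AbelianVariety.prodLift (-(d • Literature.AlgebraicGeometry.Motives.AbelianVariety.snd B₀ B₀)) (Literature.AlgebraicGeometry.Motives.AbelianVariety.fst B₀ B₀)) g = CategoryTheory.CategoryStruct.comp g φ → CategoryTheory.CategoryStruct.comp φ φ = -(d • CategoryTheory.CategoryStruct.id A) → P.IsAmple → P.IsSection 1 → P.h0 ℂ = t' → (P.pullback (Literature.AlgebraicGeometry.Motives.AbelianVariety.Hom.toSchemeHom g)).LinEquiv (N • (PB.pullback (Literature.AlgebraicGeometry.Motives.AbelianVariety.Hom.toSchemeHom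 (Literature.AlgebraicGeometry.Motives.AbelianVariety.fst B₀ B₀)) + d • PB.pullback (Literature.AlgebraicGeometry.Motives.AbelianVariety.Hom.toSchemeHom (Literature.AlgebraicGeometry.Motives.AbelianVariety.snd B₀ B₀)))) → ∃ c : Literature.AlgebraicGeometry.HodgeTheory.complexBetti A.X (2 * n), c ∈ Literature.AlgebraicGeometry.HodgeTheory.weilClassesOf A φ n d ∧ c ∉ Literature.AlgebraicGeometry.HodgeTheory.weilClassesPlus A φ n d ∧ c ∉ Literature.AlgebraicGeometry.HodgeTheory.weilClassesMinus A φ n d ∧ c ∈ ⨆ (D : Fin n → Literature.AlgebraicGeometry.Motives.CartierDivisor A.X.left) (_ : ∀ i, (D i).IsSection 1 ∧ ∃ k : ℕ, k ≤ M ∧ (D i).LinEquiv (k • P)) (_ : ∀ z ∈ {z | ∀ i, ¬ (D i).Avoids z}, ((n : ℕ) : ℕ∞) ≤ Order.coheight z), LinearMap.ker (Literature.AlgebraicGeometry.HodgeTheory.complexBetti.restrictCompl A.X {z | ∀ i, ¬ (D i).Avoids z} (2 * n)).hom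

/-- item stmt-HodgeConjecture-12681 · crux · rank 4 · open · by planner
why it might fail: It is ¬X, and HC ⇒ X (Baire: finitely many Weil components per (n,d,t,t'), bounded-degree loci closed), so it is false if HC holds; a proof gives a Hodge counterexample on an abelian variety, i.e. ¬(standard conjecture B) by André 1996 Thm 0.6.2; known degree lower bounds are per-variety/integral.
sources: Andre1996Motifs, doi:10.24033/bsmf.2236, DebarreEtAl2011, arXiv:2507.15704, Zharkov2020TropicalWeil, KollarTrento1992
[crux] NOT-X, the card's refutation branch (G2), filed ranked so that it is staffed: for some (n, d,
t, t') the minimal complexity of cycles spanning the Weil plane is unbounded along the isogeny orbit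
of the split squares. By the Baire converse of compactness this is equivalent to the failure of
Weil-class algebraicity somewhere in that family, i.e. to ¬HodgeConjecture — a counterexample format
that exhibits divergence along a tower and never a non-algebraic class on one variety. Engine: lower
bounds for the P-degree of effective cycles with non-zero Weil component on (B₀ × B₀)/G in terms of
|G| (restriction to the images of B₀ × 0, 0 × B₀ and translates, Debarre-type inequalities,
pseudoeffective cones, tropical/matroidal specialisation). [difficulty: XL] -/
@[route_item "route-HodgeConjecture-HeckeOrbitCompactness"]
def OrbitDegreeGrowth : Prop :=
  ¬ OrbitDegreeBound

/-- item stmt-HodgeConjecture-17828 · crux · rank 5 · open · by planner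
why it might fail: (x+yφ)*P ≡ (x²+dy²)P holds only ALGEBRAICALLY (Rosati); pulled-back tuples must be re-landed in |k'P| LINEARLY, effective and PROPER, with M' uniform along the whole orbit — the Pic⁰-padding/Bertini step may fail for the IsSection/LinEquiv typing at special orbit points (KILL (ii')).
sources: vanGeemen1994HodgeAV, LangeBirkenhake1992, GrothendieckTopology1969, Hartshorne1977
[crux] CHILD 2 of OrbitDegreeBound (K-saturation split, crux-strategist 2026-08-17). BOUNDED-LOSS
TRANSPORT OF P-COMPLEXITY ALONG THE ORDER ℕ[φ]: for every (n, d, t, t', x, y, M) ONE integer M' such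
that at every orbit point (binders of OrbitDegreeBound) pull-back along the endomorphism x·𝟙 + y·φ
maps SUPP_M(A, P) into SUPP_{M'}(A, P). Mechanism (each step in print): ψ = x + yφ is an isogeny of
degree (x² + dy²)^{2n} (or 0, trivial); ψ⁻¹(D₁ ∩ … ∩ Dₙ) = ψ*D₁ ∩ … ∩ ψ*Dₙ is again a proper
intersection of effective divisors (finite flat ψ; tree: preimage_nonvanishing, IsSection.pullback,
LinEquiv.pullback, complexBetti.restrictCompl_map_eq_zero, coheight_base_le_of_flat); ψ*Dᵢ ~ kᵢ·ψ*P
and ψ*P ≡ (x² + dy²)·P ALGEBRAICALLY because φ is Rosati-antisymmetric for the polarization class of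
P (Θ₀ = pr₁*P_B + d·pr₂*P_B satisfies φ₀*Θ₀ ≡ dΘ₀, g is K-equivariant and g* is injective on NS_ℚ;
van Geemen 5.2, Lange–Birkenhake §5.1); the Pic⁰-defect is absorbed by padding each ψ*Dᵢ with a
general effective member of |mP − kᵢτ| (ample, h⁰ > 0, |2L| base-point free), keeping the
intersection proper (Bertini) and landing in |k'P| LINEARLY with k' ≤ M(x² + dy²) + m. Used at (x,
1) by the glue OrbitDegr -/
@[route_item "route-HodgeConjecture-HeckeOrbitCompactness", crux]
def OrbitKTransport : Prop :=
  ∀ (n d t t' x y M : ℕ), 1 ≤ n → 0 < d → ∃ M' : ℕ, ∀ (B₀ : Literature.AlgebraicGeometry.Motives.AbelianVariety ℂ) (PB : Literature.AlgebraicGeometry.Motives.CartierDivisor B₀.X.left) [AlgebraicGeometry.IsDominant (Literature.AlgebraicGeometry.Motives.AbelianVariety.Hom.toSchemeHom (Literature.AlgebraicGeometry.Motives.AbelianVariety.fst B₀ B₀))] [AlgebraicGeometry.IsDominant (Literature.AlgebraicGeometry.Motives.AbelianVariety.Hom.toSchemeHom (Literature.AlgebraicGeometry.Motives.AbelianVariety.snd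 B₀ B₀))], B₀.dim = n → PB.IsAmple → PB.IsSection 1 → PB.h0 ℂ = t → ∀ (A : Literature.AlgebraicGeometry.Motives.AbelianVariety ℂ) (g : B₀.prod B₀ ⟶ A) (φ : A ⟶ A) (P : Literature.AlgebraicGeometry.Motives.CartierDivisor A.X.left) (N : ℕ) [AlgebraicGeometry.IsDominant (Literature.AlgebraicGeometry.Motives.AbelianVariety.Hom.toSchemeHom g)], Literature.AlgebraicGeometry.Motives.AbelianVariety.IsIsogeny g → A.dim = 2 * n → Literature.AlgebraicGeometry.Motives.IsSmoothProjective (2 * n) A.X → 1 ≤ N → CategoryTheory.CategoryStruct.comp (Literature.AlgebraicGeometry.Motives.AbelianVariety.prodLift (-(d • Literature.AlgebraicGeometry.Motives.AbelianVariety.snd B₀ B₀)) (Literature.AlgebraicGeometry.Motives.AbelianVariety.fst B₀ B₀)) g = CategoryTheory.CategoryStruct.comp g φ → CategoryTheory.CategoryStruct.comp φ φ = -(d • CategoryTheory.CategoryStruct.id A) → P.IsAmple → P.IsSection 1 → P.h0 ℂ = t' → (P.pullback (Literature.AlgebraicGeometry.Motives.AbelianVariety.Hom.toSchemeHom g)).LinEquiv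 (N • (PB.pullback (Literature.AlgebraicGeometry.Motives.AbelianVariety.Hom.toSchemeHom (Literature.AlgebraicGeometry.Motives.AbelianVariety.fst B₀ B₀)) + d • PB.pullback (Literature.AlgebraicGeometry.Motives.AbelianVariety.Hom.toSchemeHom (Literature.AlgebraicGeometry.Motives.AbelianVariety.snd B₀ B₀)))) → ∀ c : Literature.AlgebraicGeometry.HodgeTheory.complexBetti A.X (2 * n), (c ∈ ⨆ (D : Fin n → Literature.AlgebraicGeometry.Motives.CartierDivisor A.X.left) (_ : ∀ i, (D i).IsSection 1 ∧ ∃ k : ℕ, k ≤ M ∧ (D i).LinEquiv (k • P)) (_ : ∀ z ∈ {z | ∀ i, ¬ (D i).Avoids z}, ((n : ℕ) : ℕ∞) ≤ Order.coheight z), LinearMap.ker (Literature.AlgebraicGeometry.HodgeTheory.complexBetti.restrictCompl A.X {z | ∀ i, ¬ (D i).Avoids z} (2 * n)).hom) → Literature.AlgebraicTopology.SingularHomology.singularCohomology.map ℂ ℂ (Literature.AlgebraicGeometry.Motives.AlgPoints.mapContinuous (L := ℂ) (x • CategoryTheory.CategoryStruct.id A + y • φ).hom.hom.hom) (2 * n)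 c ∈ ⨆ (D : Fin n → Literature.AlgebraicGeometry.Motives.CartierDivisor A.X.left) (_ : ∀ i, (D i).IsSection 1 ∧ ∃ k : ℕ, k ≤ M' ∧ (D i).LinEquiv (k • P)) (_ : ∀ z ∈ {z | ∀ i, ¬ (D i).Avoids z}, ((n : ℕ) : ℕ∞) ≤ Order.coheight z), LinearMap.ker (Literature.AlgebraicGeometry.HodgeTheory.complexBetti.restrictCompl A.X {z | ∀ i, ¬ (D i).Avoids z} (2 * n)).hom

/-- item stmt-HodgeConjecture-12682 · crux · rank 9 · open · by planner
why it might fail: Needs (a) Zariski density of the orbit AS TYPED (g*P ∈ ℕ·Θ₀, fixed h⁰-types) in each split-disc Weil component, (b) closedness of bounded-complexity loci (relative Chow + cofinality of |kP|-tuples with degree, UNIFORM over the family), (c) descending to every disc; (a)/(b) may fail for X as typed.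
sources: CattaniDeligneKaplan1995JAMS, Voisin2007HodgeLoci, doi:10.1007/s002220100126, vanGeemen1994HodgeAV, Markman2025SurveySecant, Schoen1998HodgeWeilAddendum
[support] X → WeilClassesAlgebraic. Ingredients, each in print: (i) COMPACTNESS — over each
component S of the polarized Weil moduli (fine level) the locus D_M of points whose Weil plane lies
in the bounded span is Zariski closed (bounded-degree relative Chow schemes are proper with finitely
many components; cycle classes are locally constant; two flat sub-local-systems agree on a connected
set iff at one point), so D_M ⊇ dense orbit forces D_M = S; (ii) DENSITY — split squares have
discriminant (-1)ⁿ = the split class (Deligne–Milne Cor. 4.2; tree WeilDiscriminantSplit),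
components with equal (K, 2n, disc, type) parametrise isogenous varieties (vanGeemen1994HodgeAV §5,
Markman2025SurveySecant §11.5 Step 1), U(n,n)(ℚ) is dense in U(n,n)(ℝ); (iii) TRANSPORT along
isogenies (tree: mem_algebraicClasses_of_isogeny_of_mem_weilClassesOf); (iv) COFINALITY of the
|kP|-tuple complexity with P-degree (3P very ample, Mumford's set-theoretic generation in degree =
deg, Bertini off the base locus); (v) DESCENDING 2n+2 split ⇒ 2n every discriminant by products with
Weil surfaces (Markman2025SurveySecant §11.5 Step 2, Schoen1998HodgeWeilAddendum §10; tree
WeilClassesProducts) and Weil polarizatio -/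
@[route_item "route-HodgeConjecture-HeckeOrbitCompactness", crux]
def OrbitGlue : Prop :=
  OrbitDegreeBound → WeilClassesAlgebraic

-- earlier SummitOffWeilSector (stmt-HodgeConjecture-2528, replaced 2026-08-16T03:07:02Z -> stmt-HodgeConjecture-14189): moot by None — (∀ (n : ℕ), 2 ≤ n → ∀ (d : ℕ), 0 < d → ∀ (A : Literature.AlgebraicGeometry.Motives.AbelianVariety ℂ) (φ : A ⟶ A), A.dim = 2 * n → Literature.AlgebraicGeometry.Motives.IsSmoothProjective (2 * n) A.X → CategoryTheory.CategoryStruct.comp φ φ = -(d • CategoryTheory.Categ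
/-- item stmt-HodgeConjecture-14189 · crux · rank 9 · open · by planner
why it might fail: It is HC for everything else: non-abelian varieties (no reduction to abelian ones beyond Kuga–Satake), non-CM abelian varieties, Weil classes for CM fields of degree > 2 (André's CM reduction consumes those); HC fails for Kähler (Voisin 2002) and integrally, so it may simply be false.
sources: Deligne2000, Andre1992HodgeCM, Abdulali2005CMHodge, MoonenZarhin1998WeilClasses, Voisin2002KaehlerCounterexample, Markman2025SurveySecant
[crux] THE SUMMIT BEYOND THE WEIL SECTOR — CLAIMED by this route as its last-ranked crux
(route-repair 2026-08-16): the Hodge conjecture for every smooth projective complex variety GIVEN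
the shared sector target WeilClassesAlgebraic (Weil classes algebraic on every abelian variety of
Weil type, all imaginary quadratic K, all 2n ≥ 4), stated over that decl so that every Weil-class
route of the summit can attach to one and the same item. The route's mechanism (orbit compactness)
ends at WeilClassesAlgebraic; this item is everything after it, listed so that `closes` encompasses
the whole Statement with no unlisted open end (D-0027 §2.2). Exact status (cf.
Theorems/SummitOffWeilSector/Negative/ConjectureGrade.lean for the HeckePrymWeil twin):
HodgeConjecture → it, and ¬it ↔ (WeilClassesAlgebraic ∧ ¬HodgeConjecture) — a refutation is a
disproof of the Clay problem, a proof is HC from the Weil sector; vetting should record that and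
move on. Partial glue that counts, filed `--supports`: (a) Weil classes for ALL CM fields ⇒ HC for
all CM abelian varieties (Andre1992HodgeCM; Abdulali2005CMHodge Thm 4) — the CM reduction consumes
Weil classes for CM fields of every degree, not only the imagi -/
@[route_item "route-HodgeConjecture-HeckeOrbitCompactness", crux]
def SummitOffWeilSector : Prop :=
  WeilClassesAlgebraic → HodgeConjecture

-- earlier EightfoldOrbitBound (stmt-HodgeConjecture-12680, replaced 2026-08-15T19:35:38Z -> stmt-HodgeConjecture-13690): retired by None — ∀ (d t t' : ℕ), 0 < d → ∃ M : ℕ, ∀ (B₀ : Literature.AlgebraicGeometry.Motives.AbelianVariety ℂ) (PB : Literature.AlgebraicGeometry.Motives.CartierDivisor B₀.X.left) [AlgebraicGeometry.IsDominant (Literature.AlgebraicGeometry.Motives.AbelianVariety.Hom.toSchemeHom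
/-- item stmt-HodgeConjecture-13690 · aside · rank 3 · open · by planner
why it might fail: n = 4 is Weil's 1977 counterexample range: for imaginary quadratic K no Weil class on a general Weil-type eightfold is known algebraic; the secant variety is a proper subvariety of P(S⁺) for n ≥ 4 (2502.03415 §1.2) and the n = 4 Brill–Noether secant sheaves are 'unlikely to be semiregular' (8.2.3).
sources: Weil1977HodgeRing, Markman2025SecantWeil, Markman2025SurveySecant, WeilLocusSixfolds2026, arXiv:2509.23079, vanGeemen1994HodgeAV
[crux] X at n = 4 (literal instance; `eightfold_of_X` in Sketch.lean): the uniform bound along the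
isogeny orbit of split squares B₀ × B₀ with dim B₀ = 4. First open rung: by OrbitGlue it gives the
Weil classes on every split-type eightfold and, descending along products with Weil surfaces of
complementary discriminant (Markman2025SurveySecant §11.5 Step 2), on EVERY abelian sixfold of Weil
type — the live arena (WeilLocusSixfolds2026 §1: non-split sixfolds "resist all known methods").
[difficulty: open-problem] -/
@[route_item "route-HodgeConjecture-HeckeOrbitCompactness"]
def EightfoldOrbitBound : Prop :=
  ∀ (d t t' : ℕ), 0 < d → ∃ M : ℕ, ∀ (B₀ : Literature.AlgebraicGeometry.Motives.AbelianVariety ℂ) (PB : Literature.AlgebraicGeometry.Motives.CartierDivisor B₀.X.left) [AlgebraicGeometry.IsDominant (Literature.AlgebraicGeometry.Motives.AbelianVariety.Hom.toSchemeHom (Literature.AlgebraicGeometry.Motives.AbelianVariety.fst B₀ B₀))] [AlgebraicGeometry.IsDominant (Literature.AlgebraicGeometry.Motives.AbelianVariety.Hom.toSchemeHom (Literature.AlgebraicGeometry.Motives.AbelianVariety.snd B₀ B₀))], B₀.dim = 4 → PB.IsAmple → PB.IsSection 1 → PB.h0 ℂ = t → ∀ (A : Literature.AlgebraicGeometry.Motives.AbelianVariety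 ℂ) (g : B₀.prod B₀ ⟶ A) (φ : A ⟶ A) (P : Literature.AlgebraicGeometry.Motives.CartierDivisor A.X.left) (N : ℕ) [AlgebraicGeometry.IsDominant (Literature.AlgebraicGeometry.Motives.AbelianVariety.Hom.toSchemeHom g)], Literature.AlgebraicGeometry.Motives.AbelianVariety.IsIsogeny g → A.dim = 2 * 4 → Literature.AlgebraicGeometry.Motives.IsSmoothProjective (2 * 4) A.X → 1 ≤ N → CategoryTheory.CategoryStruct.comp (Literature.AlgebraicGeometry.Motives.AbelianVariety.prodLift (-(d • Literature.AlgebraicGeometry.Motives.AbelianVariety.snd B₀ B₀)) (Literature.AlgebraicGeometry.Motives.AbelianVariety.fst B₀ B₀)) g = CategoryTheory.CategoryStruct.comp g φ → CategoryTheory.CategoryStruct.comp φ φ = -(d • CategoryTheory.CategoryStruct.id A) → P.IsAmple → P.IsSection 1 → P.h0 ℂ = t' → (P.pullback (Literature.AlgebraicGeometry.Motives.AbelianVariety.Hom.toSchemeHom g)).LinEquiv (N • (PB.pullback (Literature.AlgebraicGeometry.Motives.AbelianVariety.Hom.toSchemeHom (Literature.AlgebraicGeometry.Motives.AbelianVariety.fst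 B₀ B₀)) + d • PB.pullback (Literature.AlgebraicGeometry.Motives.AbelianVariety.Hom.toSchemeHom (Literature.AlgebraicGeometry.Motives.AbelianVariety.snd B₀ B₀)))) → ∀ c : Literature.AlgebraicGeometry.HodgeTheory.complexBetti A.X (2 * 4), Literature.AlgebraicGeometry.HodgeTheory.IsRationalClass c → c ∈ Literature.AlgebraicGeometry.HodgeTheory.weilClassesOf A φ 4 d → c ∈ ⨆ (D : Fin 4 → Literature.AlgebraicGeometry.Motives.CartierDivisor A.X.left) (_ : ∀ i, (D i).IsSection 1 ∧ ∃ k : ℕ, k ≤ M ∧ (D i).LinEquiv (k • P)) (_ : ∀ z ∈ {z | ∀ i, ¬ (D i).Avoids z}, ((4 : ℕ) : ℕ∞) ≤ Order.coheight z), LinearMap.ker (Literature.AlgebraicGeometry.HodgeTheory.complexBetti.restrictCompl A.X {z | ∀ i, ¬ (D i).Avoids z} (2 * 4)).hom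

-- earlier FourfoldOrbitBound (stmt-HodgeConjecture-12683, replaced 2026-08-15T19:35:38Z -> stmt-HodgeConjecture-13691): retired by None — ∀ (d t t' : ℕ), 0 < d → ∃ M : ℕ, ∀ (B₀ : Literature.AlgebraicGeometry.Motives.AbelianVariety ℂ) (PB : Literature.AlgebraicGeometry.Motives.CartierDivisor B₀.X.left) [AlgebraicGeometry.IsDominant (Literature.AlgebraicGeometry.Motives.AbelianVariety.Hom.toSchemeHom 
/-- item stmt-HodgeConjecture-13691 · support · rank 9 · open · by planner
sources: Markman2025SurveySecant, Markman2025SecantWeil, vanGeemen1994HodgeAV, Schoen1988HodgeWeil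
[support] X at n = 2 (literal instance; `fourfold_of_X` in Sketch.lean) — CALIBRATION. True
non-effectively: Weil classes on every abelian fourfold of Weil type are algebraic (tree fact
Markman2025_weilClasses_algebraic_abelianFourfold = Markman2025SurveySecant Thm 1.2 + §11.5 Step 2),
so each of the finitely many components with data (d, t, t') is the countable increasing union of
the closed D_M and Baire gives one M. The EFFECTIVE M at the first deep points (isogeny degree p,
p²) of van Geemen's ℚ(i) family (vanGeemen1994HodgeAV 5.12: explicit B₀, theta cycles 4.16;
Markman's secant-sheaf supports have computable degree) is the card's computation G3 — the first
number this line can own: attach kit jobs / certified computations here (evidence kind computation);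
every NEG lower-bound technique must be tested here (it must NOT diverge). [difficulty: M] -/
@[route_item "route-HodgeConjecture-HeckeOrbitCompactness"]
def FourfoldOrbitBound : Prop :=
  ∀ (d t t' : ℕ), 0 < d → ∃ M : ℕ, ∀ (B₀ : Literature.AlgebraicGeometry.Motives.AbelianVariety ℂ) (PB : Literature.AlgebraicGeometry.Motives.CartierDivisor B₀.X.left) [AlgebraicGeometry.IsDominant (Literature.AlgebraicGeometry.Motives.AbelianVariety.Hom.toSchemeHom (Literature.AlgebraicGeometry.Motives.AbelianVariety.fst B₀ B₀))] [AlgebraicGeometry.IsDominant (Literature.AlgebraicGeometry.Motives.AbelianVariety.Hom.toSchemeHom (Literature.AlgebraicGeometry.Motives.AbelianVariety.snd B₀ B₀))], B₀.dim = 2 → PB.IsAmple → PB.IsSection 1 → PB.h0 ℂ = t → ∀ (A : Literature.AlgebraicGeometry.Motives.AbelianVariety ℂ) (g : B₀.prod B₀ ⟶ A) (φ : A ⟶ A) (P : Literature.AlgebraicGeometry.Motives.CartierDivisor A.X.left) (N : ℕ) [AlgebraicGeometry.IsDominant (Literature.AlgebraicGeometry.Motives.AbelianVariety.Hom.toSchemeHom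 g)], Literature.AlgebraicGeometry.Motives.AbelianVariety.IsIsogeny g → A.dim = 2 * 2 → Literature.AlgebraicGeometry.Motives.IsSmoothProjective (2 * 2) A.X → 1 ≤ N → CategoryTheory.CategoryStruct.comp (Literature.AlgebraicGeometry.Motives.AbelianVariety.prodLift (-(d • Literature.AlgebraicGeometry.Motives.AbelianVariety.snd B₀ B₀)) (Literature.AlgebraicGeometry.Motives.AbelianVariety.fst B₀ B₀)) g = CategoryTheory.CategoryStruct.comp g φ → CategoryTheory.CategoryStruct.comp φ φ = -(d • CategoryTheory.CategoryStruct.id A) → P.IsAmple → P.IsSection 1 → P.h0 ℂ = t' → (P.pullback (Literature.AlgebraicGeometry.Motives.AbelianVariety.Hom.toSchemeHom g)).LinEquiv (N • (PB.pullback (Literature.AlgebraicGeometry.Motives.AbelianVariety.Hom.toSchemeHom (Literature.AlgebraicGeometry.Motives.AbelianVariety.fst B₀ B₀)) + d • PB.pullback (Literature.AlgebraicGeometry.Motives.AbelianVariety.Hom.toSchemeHom (Literature.AlgebraicGeometry.Motives.AbelianVariety.snd B₀ B₀)))) → ∀ c : Literature.AlgebraicGeometry.HodgeTheory.complexBetti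 A.X (2 * 2), Literature.AlgebraicGeometry.HodgeTheory.IsRationalClass c → c ∈ Literature.AlgebraicGeometry.HodgeTheory.weilClassesOf A φ 2 d → c ∈ ⨆ (D : Fin 2 → Literature.AlgebraicGeometry.Motives.CartierDivisor A.X.left) (_ : ∀ i, (D i).IsSection 1 ∧ ∃ k : ℕ, k ≤ M ∧ (D i).LinEquiv (k • P)) (_ : ∀ z ∈ {z | ∀ i, ¬ (D i).Avoids z}, ((2 : ℕ) : ℕ∞) ≤ Order.coheight z), LinearMap.ker (Literature.AlgebraicGeometry.HodgeTheory.complexBetti.restrictCompl A.X {z | ∀ i, ¬ (D i).Avoids z} (2 * 2)).hom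

/-- item stmt-HodgeConjecture-13692 · support · rank 9 · open · by planner
sources: vanGeemen1994HodgeAV, Deligne1982HodgeCycles, GoodmanWallachGTM255, LangeBirkenhake1992, VoisinHodgeI2002
[support] X AT DEPTH ONE — the anchors themselves (literal instance of OrbitDegreeBound at A = B₀ ×
B₀, g = 𝟙, φ = φ₀ = prodLift(-d·snd, fst); `anchor_of_X : OrbitDegreeBound → AnchorDegreeBound` in
Sketch.lean, via φ₀ ≫ φ₀ = -(d•𝟙) and 𝟙^*P = P): for every (n, d, t, t') ONE M such that on every
split square B₀ × B₀ (dim B₀ = n; P_B ample, effective, h⁰ = t; Θ₀ = pr₁*P_B + d·pr₂*P_B) and for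
every effective ample P ~ N·Θ₀ (N ≥ 1, h⁰(P) = t') every rational class of the Weil plane
weilClassesOf (B₀ × B₀) φ₀ n d is supported on a proper intersection of n effective Dᵢ ~ kᵢ·P, kᵢ ≤
M. FREE ANCHORS / CALIBRATION OF THE TYPING — here HC costs nothing: W_K = det(H¹(B₀) ⊗ K) is
SL(H¹(B₀))-invariant and the Sp(H¹(B₀), ψ)-invariants of Λ(H¹ ⊕ H¹) are generated by the degree-2
invariants ψ₁₁, ψ₂₂, ψ₁₂ = c₁(pr₁*L), c₁(pr₂*L), c₁(m*L − pr₁*L − pr₂*L) (first fundamental theorem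
for Sp / skew Howe duality, GoodmanWallachGTM255), so the Weil plane lies in the divisor ring Dⁿ of
B₀ × B₀ (vanGeemen1994HodgeAV §2.4 and Thm 4.3-type argument, Deligne1982HodgeCycles §4–5; sanity n
= 1: W ⊂ NS(E × E)_ℚ = ⟨E × 0, 0 × E, Δ⟩); Bertini/moving (D + 3Θ₀ very ample on every abelian
variety, LangeBirkenhake1992 -/
@[route_item "route-HodgeConjecture-HeckeOrbitCompactness"]
def AnchorDegreeBound : Prop :=
  ∀ (n d t t' : ℕ), 1 ≤ n → 0 < d → ∃ M : ℕ, ∀ (B₀ : Literature.AlgebraicGeometry.Motives.AbelianVariety ℂ) (PB : Literature.AlgebraicGeometry.Motives.CartierDivisor B₀.X.left) [AlgebraicGeometry.IsDominant (Literature.AlgebraicGeometry.Motives.AbelianVariety.Hom.toSchemeHom (Literature.AlgebraicGeometry.Motives.AbelianVariety.fst B₀ B₀))] [AlgebraicGeometry.IsDominant (Literature.AlgebraicGeometry.Motives.AbelianVariety.Hom.toSchemeHom (Literature.AlgebraicGeometry.Motives.AbelianVariety.snd B₀ B₀))], B₀.dim = n → PB.IsAmple → PB.IsSection 1 → PB.h0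 ℂ = t → (B₀.prod B₀).dim = 2 * n → Literature.AlgebraicGeometry.Motives.IsSmoothProjective (2 * n) (B₀.prod B₀).X → ∀ (P : Literature.AlgebraicGeometry.Motives.CartierDivisor (B₀.prod B₀).X.left) (N : ℕ), 1 ≤ N → P.IsAmple → P.IsSection 1 → P.h0 ℂ = t' → P.LinEquiv (N • (PB.pullback (Literature.AlgebraicGeometry.Motives.AbelianVariety.Hom.toSchemeHom (Literature.AlgebraicGeometry.Motives.AbelianVariety.fst B₀ B₀)) + d • PB.pullback (Literature.AlgebraicGeometry.Motives.AbelianVariety.Hom.toSchemeHom (Literature.AlgebraicGeometry.Motives.AbelianVariety.snd B₀ B₀)))) → ∀ c : Literature.AlgebraicGeometry.HodgeTheory.complexBetti (B₀.prod B₀).X (2 * n), Literature.AlgebraicGeometry.HodgeTheory.IsRationalClass c → c ∈ Literature.AlgebraicGeometry.HodgeTheory.weilClassesOf (B₀.prod B₀) (Literature.AlgebraicGeometry.Motives.AbelianVariety.prodLift (-(d • Literature.AlgebraicGeometry.Motives.AbelianVariety.snd B₀ B₀)) (Literature.AlgebraicGeometry.Motives.AbelianVariety.fst B₀ B₀)) n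 d → c ∈ ⨆ (D : Fin n → Literature.AlgebraicGeometry.Motives.CartierDivisor (B₀.prod B₀).X.left) (_ : ∀ i, (D i).IsSection 1 ∧ ∃ k : ℕ, k ≤ M ∧ (D i).LinEquiv (k • P)) (_ : ∀ z ∈ {z | ∀ i, ¬ (D i).Avoids z}, ((n : ℕ) : ℕ∞) ≤ Order.coheight z), LinearMap.ker (Literature.AlgebraicGeometry.HodgeTheory.complexBetti.restrictCompl (B₀.prod B₀).X {z | ∀ i, ¬ (D i).Avoids z} (2 * n)).hom

/-- item stmt-HodgeConjecture-17829 · support · rank 9 · closed · proved by Summit.HodgeConjecture.HodgeConjecture.Theorems.heckeOrbitCompactness_weilLinesRankOne_proof @ 59c95dd387d3 (prover) · by planner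
sources: vanGeemen1994HodgeAV, Deligne1982HodgeCycles, LangeBirkenhake1992
[support] CHILD 3 of OrbitDegreeBound (K-saturation split, crux-strategist 2026-08-17). THE WEIL
EIGEN-LINES ARE LINES: for a complex abelian 2n-fold A (n ≥ 1) with φ ≫ φ = -d (d ≥ 1), each of the
simultaneous eigen-spaces E₊ = weilClassesPlus A φ n d, E₋ = weilClassesMinus A φ n d ⊆ H²ⁿ(A(ℂ); ℂ)
of the characters (x ± iy√d)^{2n} has rank ≤ 1 (any two classes, one non-zero, are proportional).
KNOWN: H•(A(ℂ); ℂ) = ⋀•H¹ compatibly with pull-backs (Lange–Birkenhake 1.1.19; tree: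
abelianVarietyCohomologyExteriorH1_holds, complexBetti_map_wedgeToCup), (x·𝟙 + y·φ)* = x + yφ* on H¹
(tree: complexBetti_map_nsmul_id_add_nsmul_one), H¹ = V₊ ⊕ V₋ with dim V± = 2n (tree:
isCompl_eigenspace_eigenspace_neg, finrank_complexBetti_one; conjugation swaps V±), so E₊ = ⋀^{2n}V₊
is a line (van Geemen, proof of Thm 6.12; Deligne–Milne (4.3)–(4.4)). Provable in the tree with real
work (exterior-power eigen-decomposition); registered skeleton
Cruxes/OrbitDegreeBound/Lines/WeilLinesRankOne_birth.lean (stubs H1PlusSpan, wedgeTransfer,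
conjSwap). Used by the glue OrbitDegreeBound_of_subs to pass from the seed's two components to the
whole Weil plane. [difficulty: M] [sources: vanGeemen1994HodgeAV, Deligne198 -/
@[route_item "route-HodgeConjecture-HeckeOrbitCompactness"]
def WeilLinesRankOne : Prop :=
  ∀ (n d : ℕ), 1 ≤ n → 0 < d → ∀ (A : Literature.AlgebraicGeometry.Motives.AbelianVariety ℂ) (φ : A ⟶ A), A.dim = 2 * n → Literature.AlgebraicGeometry.Motives.IsSmoothProjective (2 * n) A.X → CategoryTheory.CategoryStruct.comp φ φ = -(d • CategoryTheory.CategoryStruct.id A) → (∀ c ∈ Literature.AlgebraicGeometry.HodgeTheory.weilClassesPlus A φ n d, c ≠ 0 → ∀ c' ∈ Literature.AlgebraicGeometry.HodgeTheory.weilClassesPlus A φ n d, ∃ μ : ℂ, c' = μ • c) ∧ (∀ c ∈ Literature.AlgebraicGeometry.HodgeTheory.weilClassesMinus A φ n d, c ≠ 0 → ∀ c' ∈ Literature.AlgebraicGeometry.HodgeTheory.weilClassesMinus A φ n d, ∃ μ : ℂ, c' = μ • c)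

-- `WeilLinesRankOne` holds: proved by `Summit.HodgeConjecture.HodgeConjecture.Theorems.heckeOrbitCompactness_weilLinesRankOne_proof` @ 59c95dd387d3 (its module imports this route file, so no `_holds` link can be stated here).

/-- item stmt-HodgeConjecture-17832 · support · rank 9 · closed · proved by Summit.HodgeConjecture.HodgeConjecture.Theorems.heckeOrbitCompactness_orbitDegreeBoundOfSubs_proof @ a4052d9810d8 (prover) · by planner
sources: vanGeemen1994HodgeAV, Deligne1982HodgeCycles
[glue] OrbitWeilSeed → OrbitKTransport → WeilLinesRankOne → OrbitDegreeBound — the K-SATURATION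
SPLIT of the deciding crux (BC2 redirect of the RESTATED bin, crux-strategist 2026-08-17). PROVED
sorry-free: theorem OrbitDegreeBound_of_subs in Cruxes/OrbitDegreeBound/Lines/KSaturationSplit.lean
(commit 3138139cb923; lean rc 0, 0 sorries, axioms propext/Classical.choice/Quot.sound; copy
attached as evidence Split.lean on stmt-HodgeConjecture-13689), landable VERBATIM as
Theorems/HeckeOrbitCompactnessOrbitDegreeBoundSplit.lean (--supports 13689; Theorems/ is prover-only
for the strategist seat), after which this item closes by `fun h₁ h₂ h₃ => OrbitDegreeBound_of_subs
h₁ h₂ h₃`. Proof (~60 lines, not a logic seam): pick x ∈ ℕ with (x+i√d)^{2n} ≠ (x−i√d)^{2n}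
(eq_zero_of_forall_natCast_add_pow_eq); M from OrbitWeilSeed, M' from OrbitKTransport at (x, 1, M);
at an orbit point the seed c₀ = a + b (a ∈ E₊, b ∈ E₋, both ≠ 0) has (x·𝟙+1·φ)^*c₀ = λ₊a + λ₋b ∈
SUPP_{M'}; SUPP is monotone in the bound, so a, b ∈ SUPP_{max M M'} by 2×2 inversion; by
WeilLinesRankOne every class of W = ℂa ⊕ ℂb — in particular every rational Weil class — lies in
SUPP_{max M M'}. [difficulty: S — proof exists] -/
@[route_item "route-HodgeConjecture-HeckeOrbitCompactness"]
def OrbitDegreeBoundOfSubs : Prop :=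
  OrbitWeilSeed → OrbitKTransport → WeilLinesRankOne → OrbitDegreeBound

-- `OrbitDegreeBoundOfSubs` holds: proved by `Summit.HodgeConjecture.HodgeConjecture.Theorems.heckeOrbitCompactness_orbitDegreeBoundOfSubs_proof` @ a4052d9810d8 (its module imports this route file, so no `_holds` link can be stated here).

-- earlier Assembly (stmt-HodgeConjecture-12685, replaced 2026-08-16T03:29:24Z -> stmt-HodgeConjecture-14501): retired by None — OrbitDegreeBound → OrbitGlue → SummitOffWeilSector → HodgeConjecture
/-- item stmt-HodgeConjecture-14501 · assembly · rank 1 · open · by planner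
sources: Deligne2000, vanGeemen1994HodgeAV
[assembly] FRAME ITEM #1 · X → Statement — "it suffices to show X": OrbitDegreeBound →
HodgeConjecture. Restated 2026-08-16 (route-repair, ground) from the tautological form
`OrbitDegreeBound → OrbitGlue → SummitOffWeilSector → HodgeConjecture` (modus ponens twice =
literally the type of the route's deciding theorem `closes`, flagged ground.trivial/tauto by the
gate; five refuter candidate proofs of 2026-08-15 say the same). The glue steps are items of their
own — OrbitGlue : X → WeilClassesAlgebraic (support: Chow compactness + orbit density + isogeny
transport + descending) and SummitOffWeilSector : WeilClassesAlgebraic → HodgeConjecture (crux, rank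
9, the claimed complement) — so this item now records only their consequence, the thesis claim that
the uniform orbit degree bound X decides the summit; it is proved by `fun hX => hS (hG hX)` once
OrbitGlue (hG) and SummitOffWeilSector (hS) are, and `closes (hX) (hG) (hS) := hS (hG hX)` keeps its
certified shape (Assembly is not one of its hypotheses). Instrumentation value: should X turn out
vacuous or trivially true through its typing (KILL CRITERIA (ii)/(ii')), this item collapses to
HodgeConjecture itself and a refuter sees it her -/
@[route_item "route-HodgeConjecture-HeckeOrbitCompactness"]
def Assembly : Prop :=
  OrbitDegreeBound → HodgeConjecture

-- records of items no longer active in this route (dropped / restated):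
-- earlier SplitSquareAnchors (stmt-HodgeConjecture-12684, replaced 2026-08-15T19:35:38Z -> stmt-HodgeConjecture-13692): retired by None — ∀ (n d : ℕ) (B₀ : Literature.AlgebraicGeometry.Motives.AbelianVariety ℂ), 1 ≤ n → 0 < d → B₀.dim = n → ∀ c : Literature.AlgebraicGeometry.HodgeTheory.complexBetti (B₀.prod B₀).X (2 * n), Literature.AlgebraicGeometry.HodgeTheory.IsRationalClass c → c ∈ Literature.A

/-! D-0027 §2.1 — DECIDING THEOREM (planner-authored via `route open/edit --closes-file`; by planner-rbadge-HodgeConjecture-HeckeOrbitCompa-9bb2064d-g4-0 2026-08-16T04:46:43Z):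
its hypotheses are this route's items and its conclusion the sub-problem Statement (glue_lint), and it elaborates with this file. -/

/-- D-0027 §2.1 deciding theorem of route HeckeOrbitCompactness — modus ponens twice over three
CRUX items and nothing else: the uniform orbit bound `OrbitDegreeBound` (X, crux rank 2), the orbit
glue `OrbitGlue : OrbitDegreeBound → WeilClassesAlgebraic` (crux: Chow compactness + orbit density +
isogeny transport + descending, with genuine failure modes) and
`SummitOffWeilSector : WeilClassesAlgebraic → HodgeConjecture` (crux, ranked last: the Hodge
conjecture on all smooth projective varieties given the Weil-sector target). `EightfoldOrbitBound`,
`FourfoldOrbitBound` and `AnchorDegreeBound` are literal instances of X, `OrbitDegreeGrowth` is its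
negation and `Assembly` is the frame `OrbitDegreeBound → HodgeConjecture`; none of them is a
hypothesis here. -/
@[closes "route-HodgeConjecture-HeckeOrbitCompactness"] theorem closes (hX : OrbitDegreeBound) (hG : OrbitGlue) (hS : SummitOffWeilSector) :
    _root_.HodgeConjecture :=
  hS (hG hX)

end Summit.HodgeConjecture.HodgeConjecture.Theses.HeckeOrbitCompactness
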